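/-
COR-CM (cell pub-hodgecm2, stage 2 of the Hodge ladder) — junction B01 `PerLFace_of_PerL`, kernel part 2/2: the
SKELETON.  Seat prover-pub-hodgecm2-own-b01-0 (single owner of B01, COORDINATOR RULING «S6 RECORD-MOVE: GO» (vi),
2026-08-21).  Route R1 of `HOME/b01/ROUTES-B01.md` (cohomological transposition of the stage-1 engine to faces).
Two `@[conjecture]` definitions (the displayed face-scoped residuals B01-L, B01-C) and theorems; nothing cited,
nothing asserted; `Interfaces.lean` (C1), `Assembly/ModelChain*.lean` (E-DEDUP, F2, F3) untouched.
-/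
import Summits.HodgeConjecture.CorCM.B01.PeriodExpansion
import Summits.HodgeConjecture.CorCM.Interfaces
import Summits.HodgeConjecture.CorCM.Model.PerLConeFacts
import Summits.HodgeConjecture.CorCM.Geometry.BallQuotientUniformisedHolds
import Literature.AlgebraicGeometry.HodgeTheory.ComplexConjugationHolds
import Literature.AlgebraicGeometry.HodgeTheory.HodgeFiltrationModelsReductionProofs
import HarnessLib

/-!
# B01 skeleton: `PerLFace_of_PerL` from two face-scoped inputs on the model universe of record

Binder B01 of `HOME/BINDER-OWNERS.md` is the proposition `PerLFace_of_PerL` (`CorCM/Interfaces.lean` :111):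
`∀ hHD hI h₁ h₃, U.PerL → U.PerLFace` for the model universe `U = Model.picardCMUniverse hHD hI h₁ h₃`, with
`PerLFace := Universe.PeriodThmF` (rfwf v3 Thm 4.1, face form, admissible specialisation).  The tree theorem
`not_forall_perL_imp_perLFace` (`CorCM/PerLNotPerLFace.lean`) shows that no argument uniform in the universe derives
`PerLFace` from `PerL`; and the quantifier ranges of `PerL` (a sextic `K`, `[L:ℚ] ∈ {24, 48}`, `∃ V`) and of
`PeriodThmF` (`K = L = F` Galois, `6 ≤ [F:ℚ]`, `∀ V`) are disjoint, so `U.PerL` is idle: B01 is "prove `PeriodThmF` of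
the model universe".  In print (rfwf v3 §4.2 `ss:audit`, tex ll. 214–269) that proof is the TRANSPOSITION of PerL v5's
proof of its Thm 4.4 to the face setting; in the stage-1 package it is ONE engine
`HodgeCM.StubTree.thm44_of_realisation` over a `ThetaRealisation` datum, instantiated only at sextic contexts.

This file is the tree SKELETON of that transposition, in cohomological form on the model universe's own carriers
(no `L²` spaces, no automorphic datum):

* `Universe.FaceLineField U` (**B01-L**, displayed) — PerL v5 Prop 4.3 `prop:S12` transposed (rfwf §4.2 item (vi)):
  for every face datum `(F, f, ι₁, V)` there is a level `Γ` and isotypic holomorphic one-forms `ω₀ ∈ U_{Ψ₀}(Γ)`,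
  `ω₁ ∈ U_{Ψ₁}(Γ)` on `P_Γ` with `ω₀ ∪ ω₁ ≠ 0` (`Ψ = f.psi`; `U_Ψ(Γ)` = `Universe.Uiso`, the span of pull-backs of
  holomorphic `ι₁`-eigen one-forms along morphisms `P_Γ → A_{(F,Ψ)}`).  Content: theta-lift supply (Rallis / Li 1992
  for `U(1) × U(2,1)`), Albanese-isotypicity of theta one-forms ([Y1neg] Thm 8.1(a); Liu 2021 Thm 4.18), forms ↔
  cohomology (Matsushima–Murakami), and Prop 4.3's density argument (`SU(2)` transitive on lines).
* `Universe.FaceSeesawCoupling U` (**B01-C**, displayed) — PerL v5 Thm 3.7 `thm:R` (`S₁₂ = S₃₄`) with Lemma 3.5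
  (generation by (34)-wedges) and "Petersson pairing = period" (Borel–Wallach VII), transposed: every non-zero
  (12)-wedge `ω₀ ∪ ω₁` at a level `Γ` pairs non-trivially, after pull-back along some morphism of surfaces
  `g : P_{Γ'} → P_Γ`, with classes `ω₂ ∈ U_{Ψ₂}(Γ')`, `ω₃ ∈ U_{Ψ₃}(Γ')`:
  `∫_{P_{Γ'}} g^*ω₀ ∧ g^*ω₁ ∧ \overline{ω₂ ∧ ω₃} ≠ 0`.  Content: the seesaw identity, Howe duality / Rogawski's
  multiplicity one, the isolation Prop 3.6 / Thm 3.7, the level covering `P_{Γ'} → P_Γ` as a morphism of the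
  algebraic models (Arapura 2012 Cor. 15.4.6, a tree theorem, as used by the package's `Model.coverOf`).
* KERNEL: `Universe.periodThmF_of_faceInputs` — `Fact_pull_comp → FaceLineField → FaceSeesawCoupling → PeriodThmF`
  (steps 4 + 6 of the engine: `CorCM/B01/PeriodExpansion.lean`); `perLFace_of_faceInputs` — the same on
  `Model.picardCMUniverse hHD hI h₁ h₃` with `Fact_pull_comp` discharged by the tree theorem
  `Model.universeOf_fact_pull_comp`; `perLFace_of_PerL_of_faceInputs : (∀ …, FaceLineField) → (∀ …, FaceSeesawCoupling)
  → PerLFace_of_PerL` — **B01 BY NAME from B01-L and B01-C** (the `PerL` hypothesis is not used); and the closed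
  instance `perLFace_closed_of_faceInputs` on the universe of record (all four data tree theorems), whose conclusion
  is literally the hypothesis of the display `hc_cm_closed_of_perLFace` (F3, `Assembly/ModelChainClosedH1.lean`).

How the skeleton answers `not_forall_perL_imp_perLFace`: both inputs quantify over the model universe's REAL objects
— `U_Ψ(Γ) ⊂ H¹` of the chosen ball-quotient surfaces (`h₁`), genuine scheme morphisms to the chosen CM abelian
varieties (`h₃`), Betti cup product and trace; on the separating shadow universe of `PerLNotPerLFace.lean` the input
B01-L is FALSE (every pull-back to its synthetic surface over a field of degree `∉ {24,48}` vanishes), as it must be.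

Relation to the package: a face-scoped `ThetaRealisation` (package `HodgeCM/Automorphic/Realisation.lean`) on `U`
yields B01-L (its field `lineField` with `Theta_sub`, and injectivity of `Λ` on `(2,0)`-classes from `inner_Λ` +
Hodge–Riemann) and B01-C (its fields `gen12`, `S.C2_S12_eq_S34`, `real34`, `level_inf`, `cover`, `Λ_cover`,
`inner_Λ` — steps 1–5 of `thm44_of_realisation`); so B01-L ∧ B01-C is implied by the package's open input
`RealisationExistsFace` at `U` together with `ModelAxiomsPerL`, and the stage-1 binder KINDS at face scope
discharge it.  Nothing here is a claim of the manuscripts under adjudication.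
-/

noncomputable section

open scoped TensorProduct

namespace Summit.HodgeConjecture.CorCM

open Literature.AlgebraicGeometry.Motives (CMType HodgeStructure)
open Literature.AlgebraicGeometry.Motives.HodgeStructure (EndAction conj)

namespace Universe

variable (U : Universe)

/-- **B01-L `FaceLineField`** — PerL v5 Prop 4.3 (`prop:S12`, tex ll. 639–684) TRANSPOSED to the face setting
(rfwf v3 §4.2 audit item (vi), tex ll. 255–265): for every Galois CM field `F` with `6 ≤ [F:ℚ]`, every rank-four
face `f` with admissible `ι₁`, and every hermitian 3-space `(V₃,h)` of signature `(2,1)` at `ι₁`, there are a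
torsion-free congruence level `Γ` and classes `ω₀ ∈ U_{Ψ₀}(Γ)`, `ω₁ ∈ U_{Ψ₁}(Γ)` on the Picard modular surface
`P_Γ` (`Ψ = f.psi`; `U_Ψ(Γ)` = `Universe.Uiso`, spanned by pull-backs `F^*α` of holomorphic `ι₁`-eigen one-forms along
morphisms `F : P_Γ → A_{(F,Ψ)}`) whose cup product `ω₀ ∪ ω₁ ∈ H²(P_Γ, ℂ)` is non-zero.  In print: a non-zero wedge of
theta one-forms of types `(Ψ₀, Ψ₁)`.  Displayed residual input of binder B01; not asserted. -/
@[conjecture]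
def FaceLineField : Prop :=
  ∀ (F : CMField), IsGalois ℚ F → 6 ≤ Module.finrank ℚ F →
    ∀ (f : Face F) (ι₁ : F →+* ℂ), f.Admissible ι₁ →
    ∀ V : HermSpace3 F ι₁, ∃ (Γ : Level V) (ω₀ ω₁ : U.CohC (U.pms F ι₁ V Γ) 1),
      ω₀ ∈ U.Uiso Γ F (f.psi 0) ι₁ ∧ ω₁ ∈ U.Uiso Γ F (f.psi 1) ι₁ ∧
        U.cup2C (U.pms F ι₁ V Γ) 1 ω₀ ω₁ ≠ 0

/-- **B01-C `FaceSeesawCoupling`** — PerL v5 Thm 3.7 (`thm:R`, tex ll. 440–458: `S₁₂ = S₃₄`) with Lemma 3.5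
(`lem:S12`, ll. 350–353: generation of `S₃₄` by (34)-wedges) and the identification Petersson pairing = period
(Borel–Wallach VII 3.2/3.6), TRANSPOSED to the face setting (rfwf v3 §4.2 items (iii)–(v)) and read on cohomology:
for every face datum `(F, f, ι₁, V)`, every level `Γ` and every pair `ω₀ ∈ U_{Ψ₀}(Γ)`, `ω₁ ∈ U_{Ψ₁}(Γ)` with
`ω₀ ∪ ω₁ ≠ 0`, there are a level `Γ'`, a morphism of surfaces `g : P_{Γ'} → P_Γ` (in the intended model the level
covering) and classes `ω₂ ∈ U_{Ψ₂}(Γ')`, `ω₃ ∈ U_{Ψ₃}(Γ')` with non-zero period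
`∫_{P_{Γ'}} g^*ω₀ ∧ g^*ω₁ ∧ \overline{ω₂ ∧ ω₃}` (`Universe.period`).  Displayed residual input of binder B01;
not asserted. -/
@[conjecture]
def FaceSeesawCoupling : Prop :=
  ∀ (F : CMField), IsGalois ℚ F → 6 ≤ Module.finrank ℚ F →
    ∀ (f : Face F) (ι₁ : F →+* ℂ), f.Admissible ι₁ →
    ∀ (V : HermSpace3 F ι₁) (Γ : Level V) (ω₀ ω₁ : U.CohC (U.pms F ι₁ V Γ) 1),
      ω₀ ∈ U.Uiso Γ F (f.psi 0) ι₁ → ω₁ ∈ U.Uiso Γ F (f.psi 1) ι₁ →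
      U.cup2C (U.pms F ι₁ V Γ) 1 ω₀ ω₁ ≠ 0 →
        ∃ (Γ' : Level V) (g : U.Mor (U.pms F ι₁ V Γ') (U.pms F ι₁ V Γ))
          (ω₂ ω₃ : U.CohC (U.pms F ι₁ V Γ') 1),
          ω₂ ∈ U.Uiso Γ' F (f.psi 2) ι₁ ∧ ω₃ ∈ U.Uiso Γ' F (f.psi 3) ι₁ ∧
            U.period (U.pms F ι₁ V Γ') ![U.pullC g 1 ω₀, U.pullC g 1 ω₁, ω₂, ω₃] ≠ 0

variable {U}

/-- **The face-form period theorem from the two face inputs** (the engine `thm44_of_realisation` in cohomological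
form): line field (B01-L) ⇒ a non-zero (12)-wedge at some level; coupling (B01-C) ⇒ a deeper level, a morphism `g`
and (34)-classes with non-zero period against `g^*ω₀, g^*ω₁`; `U_Ψ` is pull-back stable (`Fact_pull_comp`); the
multilinear expansion gives `PeriodNV` (`periodNV_of_coupled_levels`). [folklore] -/
theorem periodThmF_of_faceInputs (hc : U.Fact_pull_comp) (hL : U.FaceLineField) (hC : U.FaceSeesawCoupling) :
    U.PeriodThmF := by
  intro F hG h6 f ι₁ hι V
  obtain ⟨Γ, ω₀, ω₁, h₀, h₁, hne⟩ := hL F hG h6 f ι₁ hι V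
  obtain ⟨Γ', g, ω₂, ω₃, h₂, h₃, hper⟩ := hC F hG h6 f ι₁ hι V Γ ω₀ ω₁ h₀ h₁ hne
  exact periodNV_of_coupled_levels hc g h₀ h₁ h₂ h₃ hper

end Universe

/-! ### The model universe -/

open Literature.NumberTheory.Automorphic.PicardCM
open Literature.AlgebraicGeometry.HodgeTheory

/-- **`PerLFace` of the model universe from its two face inputs**: on `Model.picardCMUniverse hHD hI h₁ h₃` the fact
`Fact_pull_comp` is the tree theorem `Model.universeOf_fact_pull_comp` (`BettiUniverse.pull_comp`), so B01-L and
B01-C alone give `PerLFace` (`= PeriodThmF`). [folklore] -/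
theorem perLFace_of_faceInputs (hHD : exists_isReal_hodgeModel) (hI : hodgePQ_independent_of_hodgeModel)
    (h₁ : BallQuotientUniformised) (h₃ : CMAbelianVarietyRealised)
    (hL : (Model.picardCMUniverse hHD hI h₁ h₃).FaceLineField)
    (hC : (Model.picardCMUniverse hHD hI h₁ h₃).FaceSeesawCoupling) :
    (Model.picardCMUniverse hHD hI h₁ h₃).PerLFace :=
  Universe.periodThmF_of_faceInputs
    (Model.universeOf_fact_pull_comp hHD hI (ballQuotientUniformisedDatum_of h₁) h₃) hL hC

/-- **Binder B01 BY NAME from B01-L and B01-C**: `PerLFace_of_PerL` (`CorCM/Interfaces.lean` :111) follows from the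
two face inputs demanded at every instance of the model universe; the hypothesis `U.PerL` is not used (the ranges of
`PerL` and `PeriodThmF` are disjoint — `HOME/chain/SECTION-1` rows B11, D1). [folklore] -/
theorem perLFace_of_PerL_of_faceInputs
    (hL : ∀ (hHD : exists_isReal_hodgeModel) (hI : hodgePQ_independent_of_hodgeModel)
      (h₁ : BallQuotientUniformised) (h₃ : CMAbelianVarietyRealised),
      (Model.picardCMUniverse hHD hI h₁ h₃).FaceLineField)
    (hC : ∀ (hHD : exists_isReal_hodgeModel) (hI : hodgePQ_independent_of_hodgeModel)
      (h₁ : BallQuotientUniformised) (h₃ : CMAbelianVarietyRealised),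
      (Model.picardCMUniverse hHD hI h₁ h₃).FaceSeesawCoupling) :
    PerLFace_of_PerL :=
  fun hHD hI h₁ h₃ _ => perLFace_of_faceInputs hHD hI h₁ h₃ (hL hHD hI h₁ h₃) (hC hHD hI h₁ h₃)

/-- **The closed instance**: on the model universe OF RECORD (all four data tree theorems:
`exists_isReal_hodgeModel_holds`, `hodgePQ_independent_of_hodgeModel_holds`, `BallQuotient.ballQuotientUniformised_holds`,
`cmAbelianVarietyRealised_holds`) the two face inputs give `PerLFace` — literally the hypothesis of the display
`hc_cm_closed_of_perLFace` (F3). [folklore] -/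
theorem perLFace_closed_of_faceInputs
    (hL : (Model.picardCMUniverse exists_isReal_hodgeModel_holds hodgePQ_independent_of_hodgeModel_holds
      BallQuotient.ballQuotientUniformised_holds cmAbelianVarietyRealised_holds).FaceLineField)
    (hC : (Model.picardCMUniverse exists_isReal_hodgeModel_holds hodgePQ_independent_of_hodgeModel_holds
      BallQuotient.ballQuotientUniformised_holds cmAbelianVarietyRealised_holds).FaceSeesawCoupling) :
    (Model.picardCMUniverse exists_isReal_hodgeModel_holds hodgePQ_independent_of_hodgeModel_holds
      BallQuotient.ballQuotientUniformised_holds cmAbelianVarietyRealised_holds).PerLFace :=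
  perLFace_of_faceInputs _ _ _ _ hL hC

end Summit.HodgeConjecture.CorCM

end
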